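import Summits.HodgeConjecture.HodgeConjecture.Theorems.R90S6TwistedHyperbolicHeckeFLValuePinned   -- TB2d FILE C-PIN (this seat): (C.1∕2∕3-PIN), (C.3-ONE); brings ★ 2c-A∕B, ★ 2a∕2b, ★ 1c, ★ TJ1, ★ TB2d B, ★ `Ch4Sec10` (`epsOrbitalIntegral`)
import HarnessLib

/-!
# R90 · S6 «Ch. 14.1–14.5 stable trace formula» — PIN 3: THE `ℂ`-VALUED (BOCHNER) READING OF THE ε-TWISTED ORBITAL INTEGRAL OF `𝟙_{K̃ϖ^λK̃}` IN
# ★ `Ch4Sec10.epsOrbitalIntegral` CURRENCY — `Φ_ε(δ, 𝟙_{K̃ϖ^λK̃}; ν∕t) = J(δ) · N_k(λ)` (`Theorems/R90S6TwistedHeckeFLValueComplex.lean`)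

Cell `hodgecm-mathlib`, crux H413 (`stmt-HodgeConjecture-24833`), route of record `HCCMUnconditional`; programme R90-TF (brief `director/R90-BRIEF.v2.md`), section S6
(base `R90-C14`), seat R90-C14-p06 (g2); dealer R90-C14-plan (g3) RULINGS #14 (R44) 03:52:35Z («PIN 3 = `R90S6TwistedHeckeFLValueComplex`: the ℝ≥0∞ → ℂ reading of
(C.3-ONE) in ★ `Ch4Sec10.epsOrbitalIntegral` currency = the `hTO` binder of ★ TB2d A (A.2) token for token»).  Lane `--kind proof --supports stmt-HodgeConjecture-24833
--as helper`; THEOREMS ONLY (no definition ∕ instance ∕ notation ∕ named fact ∕ `sorry`); junction bytes of ★ TB2d A∕B∕C∕C-PIN, ★ 2a∕2b∕2c untouched.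

## THE PRINT AND THE CURRENCY
[Rogawski1990, §1.6 pp. 5–6; §4.10 (4.10.1)–(4.10.2) pp. 57–59; §4.3 (4.3.1) p. 43].  ★ `Ch4Sec10.epsOrbitalIntegral ε δ φ m := ∫ y, descEpsConj ε δ G̃_{δε} φ y ∂m` is a
BOCHNER integral over the quotient `G̃ ⧸ G̃_{δε}` against a parameter measure `m`; ★ TB2d A (A.2)'s binder is `hTO : classEpsOrbitalIntegral ε mt φ c₀ = J * S` over
`ℂ`, i.e. `epsOrbitalIntegral ε (out c₀) φ (mt c₀) = J * S` (★ `Ch4Sec10` :178).  ★ C-PIN computes the `ℝ≥0∞`-valued `lintegral` of the SAME descended indicator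
against the canonical `ν∕t`.  Since `descEpsConj ε δ M φ = φ ∘ descEpsConj ε δ M id` DEFINITIONALLY, both integrands are the indicator of the Borel set
`S′ = (descEpsConj ε δ G̃_{δε} id)⁻¹(K̃ϖ^λK̃)` (the descended twisted-conjugation map is continuous for continuous `ε`), and `∫ 𝟙_{S′} dm = (m S′).toReal`
(Mathlib `integral_indicator_const` — for ANY measure: an infinite mass reads `0` on both sides), `∫⁻ 𝟙_{S′} dm = m S′`.

## WHAT IS PROVED (namespace `Summit.HodgeConjecture.HodgeConjecture.R90.S6`)
* §1 (generic `G̃`, `ε` continuous) **`epsOrbitalIntegral_indicator_eq_coe_toReal_lintegral`**: for every Borel `S ⊆ G̃` and every `m`,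
  `epsOrbitalIntegral ε δ (S.indicator (1 : G̃ → ℂ)) m = ((∫⁻ y, descEpsConj ε δ G̃_{δε} (S.indicator (1 : G̃ → ℝ≥0∞)) y ∂m).toReal : ℂ)`.
* §2 (`GL₃`, frame = ★ C-PIN's VERBATIM, `m := quotientMeasure (epsCentralizer ε δ) t hT ν`):
  (X.1) `epsOrbitalIntegral_indicator_zpowDiagGL_quotientMeasure_eq` — `Φ_ε(δ, 𝟙_{K̃ϖ^λK̃}; ν∕t) = ((ν K̃ ∕ t(T ∩ K̃)).toReal : ℂ) · (J(δ) : ℂ) ·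
  (if 2 ∣ Σλ − Σe(δ) then (N_k(λ) : ℂ) else 0)`, `N_k(λ) = Σ_{μ ∈ e(O_λ), μ₀−μ₂ = e(δ)₀−e(δ)₂} #{γ ∈ O_λ : e γ = μ} ∈ ℕ` (cast ONCE);
  (X.2) `epsOrbitalIntegral_indicator_zpowDiagGL_quotientMeasure_eq_zero_of_not_even` — the SELECTION RULE in `ℂ`;
  (X.3-ONE) `epsOrbitalIntegral_indicator_zpowDiagGL_quotientMeasure_eq_mul_natCast_of_measure_eq_one` — under `ν(K̃) = 1`, `t(T ∩ K̃) = 1` and parity,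
  **`Φ_ε(δ, 𝟙_{K̃ϖ^λK̃}; ν∕t) = (J(δ) : ℂ) · (N_k(λ) : ℂ)`** — the shape `J * S` of ★ (A.2)'s `hTO` with `J := ↑J(δ)` (★ TJ1: `(‖d₂∕d₁·σ(d₁∕d₀) − 1‖ ·
  √‖1 − d₂∕d₀·σ(d₂∕d₀)‖)⁻¹`) and `S := (N_k(λ) : ℂ)`, which ★ TB2d B (B.4) `cast_sum_normFibre_card_cells_eq_mul_coeff_satakeTransform_bcGraphPartner` reads as
  `u^{2k} · (𝒮_w(b c_λ))_{ℓ_k}` by name.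

HONEST LABEL: PIN 3 only (the Bochner reading at `δ`); PIN 4 — the step `δ ↦ Quotient.out c₀` with the family member `mt c₀` and the carrier junction `K = L_w` —
remains the assembler's (G5 ∕ D ED. 6); `α`, `t′` stay auxiliary hypotheses (★ CanonicalOne convention).  Count-neutral Bochner bookkeeping; discharges no named
input.  HC_CM is proved only modulo the 7 printed citations (2 remaining named inputs: hLiu418 = `stmt-HodgeConjecture-24832`, h413 =
`stmt-HodgeConjecture-24833`) until rung 0 closes; REL ≠ ★ ≠ BUILT.

## Tree search
★ `Ch4Sec10.{epsOrbitalIntegral, descEpsConj, epsCentralizer, mem_epsCentralizer_iff}`; ★ C-PIN `lintegral_descEpsConj_indicator_zpowDiagGL_quotientMeasure_eq_{zero_of_not_even,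
mul_natCast_sum_normFibre, mul_natCast_sum_normFibre_of_measure_eq_one}`; ★ 2b `isOpen_doubleCoset_glInt`; Mathlib `integral_indicator_const`, `lintegral_indicator_one`,
`Set.indicator_comp_right`, `measureReal_def`, `ENNReal.toReal_mul`, `ENNReal.toReal_natCast`, `ENNReal.coe_toReal`.  ★ J1′'s Bochner bridge is `private` (p04's hand-over
note) — re-proved here in 25 lines.  Dedup: `rg "epsOrbitalIntegral_indicator"` — no hit.

## References
* [Rogawski1990] J. D. Rogawski, *Automorphic Representations of Unitary Groups in Three Variables*, Ann. of Math. Stud. 123 (1990), §1.6 pp. 5–6, §4.3 (4.3.1)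
  p. 43, §4.10 (4.10.1)–(4.10.2), Prop. 4.10.2 pp. 57–59.
* [Kottwitz1986BaseChangeUnits] R. Kottwitz, *Base change for unit elements of Hecke algebras*, Compositio Math. 60 (1986), §3.
* [CartierCorvallis1979] P. Cartier, *Representations of 𝔭-adic groups: a survey*, PSPM 33.1 (1979), §IV (4.2) p. 146.
-/

set_option autoImplicit false
-- the mandated namespace repeats the single-problem summit's segment (`HodgeConjecture.HodgeConjecture`)
set_option linter.dupNamespace false

noncomputable section

open MeasureTheory Measure Set Function Filter Topology
open scoped ENNReal NNReal Pointwise MatrixGroups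
open ValuativeRel MulAction Finset
open Literature.NumberTheory.Automorphic Literature.MeasureTheory.Group Literature.NumberTheory.Rogawski1990.Ch4Sec10
open Literature.NumberTheory.GaloisRepresentations Literature.NumberTheory.GaloisRepresentations.IsNonarchimedeanLocalField
open Literature.NumberTheory.Automorphic.heckeAlgebra

namespace Summit.HodgeConjecture.HodgeConjecture.R90.S6

/-! ## §1 The Bochner ∕ `lintegral` bridge for descended indicators (generic `G̃`) -/

section Bridge

variable {G : Type*} [Group G] (ε : G →* G) (δ : G)

/-- `descEpsConj ε δ G_{δε} φ (g G_{δε}) = φ(g δ ε(g)⁻¹)` (local copy of ★ 1c's private lemma). [cite: Rogawski1990, §1.6 p. 5] -/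
private theorem descEpsConj_apply_mk_complex {β : Type*} (φ : G → β) (g : G) :
    descEpsConj ε δ (epsCentralizer ε δ) φ (QuotientGroup.mk g : G ⧸ epsCentralizer ε δ) = φ (g * δ * (ε g)⁻¹) := by
  obtain ⟨m, hm⟩ := QuotientGroup.mk_out_eq_mul (epsCentralizer ε δ) g
  have hmδ : (m : G) * δ * (ε (m : G))⁻¹ = δ := (mem_epsCentralizer_iff ε δ _).1 m.2
  unfold descEpsConj
  rw [hm, map_mul]
  congr 1
  calc g * (m : G) * δ * (ε g * ε (m : G))⁻¹ = g * ((m : G) * δ * (ε (m : G))⁻¹) * (ε g)⁻¹ := by group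
    _ = g * δ * (ε g)⁻¹ := by rw [hmδ]

variable [TopologicalSpace G] [IsTopologicalGroup G]

/-- the descended twisted-conjugation map `y G_{δε} ↦ y δ ε(y)⁻¹` is continuous for continuous `ε`. [folklore] -/
private theorem continuous_descEpsConj_id (hε : Continuous ε) : Continuous (descEpsConj ε δ (epsCentralizer ε δ) (id : G → G)) := by
  have hcomp : descEpsConj ε δ (epsCentralizer ε δ) (id : G → G) ∘ (QuotientGroup.mk : G → G ⧸ epsCentralizer ε δ) =
      fun g => g * δ * (ε g)⁻¹ :=
    funext fun g => descEpsConj_apply_mk_complex ε δ id g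
  rw [← QuotientGroup.isOpenQuotientMap_mk.continuous_comp_iff, hcomp]
  exact (continuous_id.mul continuous_const).mul (hε.comp continuous_id).inv

variable [MeasurableSpace G] [BorelSpace G] [MeasurableSpace (G ⧸ epsCentralizer ε δ)] [BorelSpace (G ⧸ epsCentralizer ε δ)]

/-- **THE BOCHNER ∕ `lintegral` BRIDGE FOR A DESCENDED INDICATOR.**  For `ε` continuous, `S ⊆ G̃` Borel and ANY measure `m` on `G̃ ⧸ G̃_{δε}`:
`Φ_ε(δ, 𝟙_S; m) = epsOrbitalIntegral ε δ (𝟙_S : G̃ → ℂ) m = ((∫⁻ 𝟙_S(y δ ε(y)⁻¹) dm(y)).toReal : ℂ)` — both integrands are the indicator of the Borel set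
`S′ = {yG̃_{δε} : y δ ε(y)⁻¹ ∈ S}` (`descEpsConj ε δ M φ = φ ∘ descEpsConj ε δ M id` definitionally), `∫ 𝟙_{S′} dm = (m S′).toReal` (Mathlib `integral_indicator_const`,
no finiteness needed) and `∫⁻ 𝟙_{S′} dm = m S′`.  (★ J1′'s bridge is private; this is the public edition in ★ `Ch4Sec10` currency.) [cite: Rogawski1990, §1.6 pp. 5–6; §4.10 p. 57] -/
theorem epsOrbitalIntegral_indicator_eq_coe_toReal_lintegral (hε : Continuous ε) {S : Set G} (hS : MeasurableSet S)
    (m : Measure (G ⧸ epsCentralizer ε δ)) :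
    epsOrbitalIntegral ε δ (S.indicator (1 : G → ℂ)) m =
      ((∫⁻ y, descEpsConj ε δ (epsCentralizer ε δ) (S.indicator (1 : G → ℝ≥0∞)) y ∂m).toReal : ℂ) := by
  set S' : Set (G ⧸ epsCentralizer ε δ) := (descEpsConj ε δ (epsCentralizer ε δ) (id : G → G)) ⁻¹' S with hS'
  have hS'm : MeasurableSet S' := hS.preimage (continuous_descEpsConj_id ε δ hε).measurable
  have h1 : descEpsConj ε δ (epsCentralizer ε δ) (S.indicator (1 : G → ℂ)) = S'.indicator (fun _ => (1 : ℂ)) := by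
    funext q
    change S.indicator (1 : G → ℂ) (descEpsConj ε δ (epsCentralizer ε δ) (id : G → G) q) = _
    rw [← Set.indicator_comp_right, Pi.one_comp]
    rfl
  have h2 : descEpsConj ε δ (epsCentralizer ε δ) (S.indicator (1 : G → ℝ≥0∞)) = S'.indicator (1 : G ⧸ epsCentralizer ε δ → ℝ≥0∞) := by
    funext q
    change S.indicator (1 : G → ℝ≥0∞) (descEpsConj ε δ (epsCentralizer ε δ) (id : G → G) q) = _
    rw [← Set.indicator_comp_right, Pi.one_comp]
  unfold epsOrbitalIntegral
  rw [h1, h2, integral_indicator_const (1 : ℂ) hS'm, lintegral_indicator_one hS'm, measureReal_def, Complex.real_smul, mul_one]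

end Bridge

/-! ## §2 The `ℂ`-valued value of `Φ_ε(δ, 𝟙_{K̃ϖ^λK̃}; ν∕t)` on `GL₃` -/

section Value

-- the frame of ★ TB2d FILE C-PIN, VERBATIM
variable {K : Type*} [Field K] [ValuativeRel K] [TopologicalSpace K] [IsNonarchimedeanLocalField K] [MeasurableSpace K] [BorelSpace K]
  [IsDiscreteValuationRing 𝒪[K]] {ϖ : K} (hϖ : IsUniformizingElement ϖ)
  [MeasurableSpace (GL (Fin 3) K)] [BorelSpace (GL (Fin 3) K)]
  (σ : K →+* K) (hσ : ∀ x, σ (σ x) = x) (hσc : Continuous σ)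
  (ε : GL (Fin 3) K →* GL (Fin 3) K) (hε : Continuous ε) (hεΘ : ∀ g, ε g = UnitaryGroup.qsInvolution σ g)
  (hεK : ∀ k ∈ glInt 3 K, ε k ∈ glInt 3 K)
  (δ : GL (Fin 3) K) (d : Fin 3 → K) (hδ : (δ : Matrix (Fin 3) (Fin 3) K) = Matrix.diagonal d)

include hϖ hσ hσc hε hεΘ hεK hδ in
/-- **(X.1) THE `ℂ`-VALUED ε-TWISTED ORBITAL INTEGRAL OF `𝟙_{K̃ϖ^λK̃}` AT AN ε-SPLIT `δ` AGAINST `ν∕t`** (★ `Ch4Sec10.epsOrbitalIntegral` currency): in ★ C-PIN's frame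
VERBATIM, for every `λ : Fin 3 → ℤ`, with `N_k(λ) = Σ_{μ ∈ e(O_λ), μ₀ − μ₂ = e(δ)₀ − e(δ)₂} #{γ ∈ O_λ : e γ = μ} ∈ ℕ`,
`Φ_ε(δ, 𝟙_{K̃ϖ^λK̃}; ν∕t) = ((ν(K̃) ∕ t(T ∩ K̃)).toReal : ℂ) · (J(δ) : ℂ) · (if 2 ∣ Σλ − Σ e(δ) then (N_k(λ) : ℂ) else 0)` — §1's bridge over ★ C-PIN (C.2)∕(C.3).
[cite: Rogawski1990, §4.10 (4.10.1) p. 57, Prop. 4.10.2 proof pp. 58–59; §4.3 (4.3.1) p. 43] [cite: Kottwitz1986BaseChangeUnits, §3] [cite: CartierCorvallis1979, §IV (4.2) p. 146] -/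
theorem epsOrbitalIntegral_indicator_zpowDiagGL_quotientMeasure_eq (hσ1 : ∃ x, σ x ≠ x)
    [T2Space (GL (Fin 3) K)] [SecondCountableTopology (GL (Fin 3) K)] [LocallyCompactSpace (GL (Fin 3) K)]
    [IsHeckeTriple (⊤ : Submonoid (GL (Fin 3) K)) (glInt 3 K) (glInt 3 K)]
    (ha : d 2 / d 1 * σ (d 1 / d 0) - 1 ≠ 0) (hb : 1 - d 2 / d 0 * σ (d 2 / d 0) ≠ 0)
    {A : Subgroup (GL (Fin 3) K)} (hAid : A = standardLeviGL K (_root_.id : Fin 3 → Fin 3)) (hA : IsClosed (A : Set (GL (Fin 3) K)))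
    (hT : IsClosed (epsCentralizer ε δ : Set (GL (Fin 3) K))) (hTA : epsCentralizer ε δ ≤ A)
    [MeasurableSpace (GL (Fin 3) K ⧸ epsCentralizer ε δ)] [BorelSpace (GL (Fin 3) K ⧸ epsCentralizer ε δ)]
    [MeasurableSpace (GL (Fin 3) K ⧸ A)] [BorelSpace (GL (Fin 3) K ⧸ A)]
    [MeasurableSpace (↥A ⧸ (epsCentralizer ε δ).subgroupOf A)] [BorelSpace (↥A ⧸ (epsCentralizer ε δ).subgroupOf A)]
    (ν : Measure (GL (Fin 3) K)) [IsHaarMeasure ν] [ν.IsMulRightInvariant]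
    (α : Measure ↥A) [IsHaarMeasure α] [α.IsMulRightInvariant] [α.IsInvInvariant]
    (t : Measure ↥(epsCentralizer ε δ)) [IsHaarMeasure t] [t.IsInvInvariant]
    (t' : Measure ↥((epsCentralizer ε δ).subgroupOf A)) [IsHaarMeasure t'] [t'.IsInvInvariant]
    (ht' : t' = Measure.map (Subgroup.subgroupOfEquivOfLe hTA).symm t) (lam : Fin 3 → ℤ) :
    epsOrbitalIntegral ε δ
        (((glInt 3 K : Set (GL (Fin 3) K)) * {zpowDiagGL hϖ.ne_zero lam} * (glInt 3 K : Set (GL (Fin 3) K))).indicator (1 : GL (Fin 3) K → ℂ))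
        (quotientMeasure (epsCentralizer ε δ) t hT ν) =
      ((ν (glInt 3 K : Set (GL (Fin 3) K)) / t (Subtype.val ⁻¹' (glInt 3 K : Set (GL (Fin 3) K)))).toReal : ℂ) *
        ((((normAbs K (d 2 / d 1 * σ (d 1 / d 0) - 1))⁻¹ * (NNReal.sqrt (normAbs K (1 - d 2 / d 0 * σ (d 2 / d 0))))⁻¹ : ℝ≥0) : ℝ) : ℂ) *
        (if 2 ∣ ∑ i, lam i - ∑ i, iwasawaExp hϖ δ i then
          ((∑ μ ∈ ((finite_orbit_quotient (glInt 3 K) (zpowDiagGL hϖ.ne_zero lam)).toFinset.image fun γ => iwasawaExp hϖ γ.out) with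
                μ 0 - μ 2 = iwasawaExp hϖ δ 0 - iwasawaExp hϖ δ 2,
              ((finite_orbit_quotient (glInt 3 K) (zpowDiagGL hϖ.ne_zero lam)).toFinset.filter fun γ => iwasawaExp hϖ γ.out = μ).card : ℕ) : ℂ)
        else 0) := by
  rw [epsOrbitalIntegral_indicator_eq_coe_toReal_lintegral ε δ hε (isOpen_doubleCoset_glInt _).measurableSet]
  by_cases hpar : 2 ∣ ∑ i, lam i - ∑ i, iwasawaExp hϖ δ i
  · rw [lintegral_descEpsConj_indicator_zpowDiagGL_quotientMeasure_eq_mul_natCast_sum_normFibre hϖ σ hσ hσc ε hε hεΘ hεK δ d hδ hσ1 ha hb hAid hA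
        hT hTA ν α t t' ht' hpar, if_pos hpar, ENNReal.toReal_mul, ENNReal.toReal_mul, ENNReal.coe_toReal, ENNReal.toReal_natCast,
      Complex.ofReal_mul, Complex.ofReal_mul, Complex.ofReal_natCast]
  · rw [lintegral_descEpsConj_indicator_zpowDiagGL_quotientMeasure_eq_zero_of_not_even hϖ σ hσ hσc ε hε hεΘ hεK δ d hδ hσ1 ha hb hAid hA hT hTA
        ν α t t' ht' hpar, if_neg hpar, ENNReal.toReal_zero, Complex.ofReal_zero, mul_zero]

include hϖ hσ hσc hε hεΘ hεK hδ in
/-- **(X.2) THE SELECTION RULE IN `ℂ`**: if `Σλ ≢ Σ e(δ) (mod 2)` then `Φ_ε(δ, 𝟙_{K̃ϖ^λK̃}; ν∕t) = 0` (★ C-PIN (C.2) through §1's bridge).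
[cite: Rogawski1990, §4.10 (4.10.1) p. 57; §3.11 p. 35] [cite: Kottwitz1986BaseChangeUnits, §3] -/
theorem epsOrbitalIntegral_indicator_zpowDiagGL_quotientMeasure_eq_zero_of_not_even (hσ1 : ∃ x, σ x ≠ x)
    [T2Space (GL (Fin 3) K)] [SecondCountableTopology (GL (Fin 3) K)] [LocallyCompactSpace (GL (Fin 3) K)]
    [IsHeckeTriple (⊤ : Submonoid (GL (Fin 3) K)) (glInt 3 K) (glInt 3 K)]
    (ha : d 2 / d 1 * σ (d 1 / d 0) - 1 ≠ 0) (hb : 1 - d 2 / d 0 * σ (d 2 / d 0) ≠ 0)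
    {A : Subgroup (GL (Fin 3) K)} (hAid : A = standardLeviGL K (_root_.id : Fin 3 → Fin 3)) (hA : IsClosed (A : Set (GL (Fin 3) K)))
    (hT : IsClosed (epsCentralizer ε δ : Set (GL (Fin 3) K))) (hTA : epsCentralizer ε δ ≤ A)
    [MeasurableSpace (GL (Fin 3) K ⧸ epsCentralizer ε δ)] [BorelSpace (GL (Fin 3) K ⧸ epsCentralizer ε δ)]
    [MeasurableSpace (GL (Fin 3) K ⧸ A)] [BorelSpace (GL (Fin 3) K ⧸ A)]
    [MeasurableSpace (↥A ⧸ (epsCentralizer ε δ).subgroupOf A)] [BorelSpace (↥A ⧸ (epsCentralizer ε δ).subgroupOf A)]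
    (ν : Measure (GL (Fin 3) K)) [IsHaarMeasure ν] [ν.IsMulRightInvariant]
    (α : Measure ↥A) [IsHaarMeasure α] [α.IsMulRightInvariant] [α.IsInvInvariant]
    (t : Measure ↥(epsCentralizer ε δ)) [IsHaarMeasure t] [t.IsInvInvariant]
    (t' : Measure ↥((epsCentralizer ε δ).subgroupOf A)) [IsHaarMeasure t'] [t'.IsInvInvariant]
    (ht' : t' = Measure.map (Subgroup.subgroupOfEquivOfLe hTA).symm t)
    {lam : Fin 3 → ℤ} (hpar : ¬ 2 ∣ ∑ i, lam i - ∑ i, iwasawaExp hϖ δ i) :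
    epsOrbitalIntegral ε δ
        (((glInt 3 K : Set (GL (Fin 3) K)) * {zpowDiagGL hϖ.ne_zero lam} * (glInt 3 K : Set (GL (Fin 3) K))).indicator (1 : GL (Fin 3) K → ℂ))
        (quotientMeasure (epsCentralizer ε δ) t hT ν) = 0 := by
  rw [epsOrbitalIntegral_indicator_eq_coe_toReal_lintegral ε δ hε (isOpen_doubleCoset_glInt _).measurableSet,
    lintegral_descEpsConj_indicator_zpowDiagGL_quotientMeasure_eq_zero_of_not_even hϖ σ hσ hσc ε hε hεΘ hεK δ d hδ hσ1 ha hb hAid hA hT hTA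
      ν α t t' ht' hpar, ENNReal.toReal_zero, Complex.ofReal_zero]

include hϖ hσ hσc hε hεΘ hεK hδ in
/-- **(X.3-ONE) THE `hTO` SHAPE AT ROGAWSKI'S NORMALISATION**: under `ν(K̃) = 1`, `t(T ∩ K̃) = 1` and `Σλ ≡ Σ e(δ) (mod 2)`,
**`Φ_ε(δ, 𝟙_{K̃ϖ^λK̃}; ν∕t) = (J(δ) : ℂ) · (N_k(λ) : ℂ)`** in ★ `Ch4Sec10.epsOrbitalIntegral` currency — the `J * S` of ★ TB2d A (A.2)'s `hTO` with `J := ↑J(δ)` (★ TJ1)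
and `S := (N_k(λ) : ℂ)`, which ★ TB2d B (B.4) reads as `u^{2k} · (𝒮_w(b c_λ))_{ℓ_k}` by name.
[cite: Rogawski1990, §4.3 (4.3.1) p. 43; §4.10 Prop. 4.10.2 proof pp. 58–59] [cite: CartierCorvallis1979, §IV (4.2) p. 146] -/
theorem epsOrbitalIntegral_indicator_zpowDiagGL_quotientMeasure_eq_mul_natCast_of_measure_eq_one (hσ1 : ∃ x, σ x ≠ x)
    [T2Space (GL (Fin 3) K)] [SecondCountableTopology (GL (Fin 3) K)] [LocallyCompactSpace (GL (Fin 3) K)]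
    [IsHeckeTriple (⊤ : Submonoid (GL (Fin 3) K)) (glInt 3 K) (glInt 3 K)]
    (ha : d 2 / d 1 * σ (d 1 / d 0) - 1 ≠ 0) (hb : 1 - d 2 / d 0 * σ (d 2 / d 0) ≠ 0)
    {A : Subgroup (GL (Fin 3) K)} (hAid : A = standardLeviGL K (_root_.id : Fin 3 → Fin 3)) (hA : IsClosed (A : Set (GL (Fin 3) K)))
    (hT : IsClosed (epsCentralizer ε δ : Set (GL (Fin 3) K))) (hTA : epsCentralizer ε δ ≤ A)
    [MeasurableSpace (GL (Fin 3) K ⧸ epsCentralizer ε δ)] [BorelSpace (GL (Fin 3) K ⧸ epsCentralizer ε δ)]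
    [MeasurableSpace (GL (Fin 3) K ⧸ A)] [BorelSpace (GL (Fin 3) K ⧸ A)]
    [MeasurableSpace (↥A ⧸ (epsCentralizer ε δ).subgroupOf A)] [BorelSpace (↥A ⧸ (epsCentralizer ε δ).subgroupOf A)]
    (ν : Measure (GL (Fin 3) K)) [IsHaarMeasure ν] [ν.IsMulRightInvariant]
    (α : Measure ↥A) [IsHaarMeasure α] [α.IsMulRightInvariant] [α.IsInvInvariant]
    (t : Measure ↥(epsCentralizer ε δ)) [IsHaarMeasure t] [t.IsInvInvariant]
    (t' : Measure ↥((epsCentralizer ε δ).subgroupOf A)) [IsHaarMeasure t'] [t'.IsInvInvariant]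
    (ht' : t' = Measure.map (Subgroup.subgroupOfEquivOfLe hTA).symm t)
    (hν : ν (glInt 3 K : Set (GL (Fin 3) K)) = 1) (ht : t (Subtype.val ⁻¹' (glInt 3 K : Set (GL (Fin 3) K))) = 1)
    {lam : Fin 3 → ℤ} (hpar : 2 ∣ ∑ i, lam i - ∑ i, iwasawaExp hϖ δ i) :
    epsOrbitalIntegral ε δ
        (((glInt 3 K : Set (GL (Fin 3) K)) * {zpowDiagGL hϖ.ne_zero lam} * (glInt 3 K : Set (GL (Fin 3) K))).indicator (1 : GL (Fin 3) K → ℂ))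
        (quotientMeasure (epsCentralizer ε δ) t hT ν) =
      ((((normAbs K (d 2 / d 1 * σ (d 1 / d 0) - 1))⁻¹ * (NNReal.sqrt (normAbs K (1 - d 2 / d 0 * σ (d 2 / d 0))))⁻¹ : ℝ≥0) : ℝ) : ℂ) *
        ((∑ μ ∈ ((finite_orbit_quotient (glInt 3 K) (zpowDiagGL hϖ.ne_zero lam)).toFinset.image fun γ => iwasawaExp hϖ γ.out) with
              μ 0 - μ 2 = iwasawaExp hϖ δ 0 - iwasawaExp hϖ δ 2,
            ((finite_orbit_quotient (glInt 3 K) (zpowDiagGL hϖ.ne_zero lam)).toFinset.filter fun γ => iwasawaExp hϖ γ.out = μ).card : ℕ) : ℂ) := by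
  rw [epsOrbitalIntegral_indicator_eq_coe_toReal_lintegral ε δ hε (isOpen_doubleCoset_glInt _).measurableSet,
    lintegral_descEpsConj_indicator_zpowDiagGL_quotientMeasure_eq_mul_natCast_sum_normFibre_of_measure_eq_one hϖ σ hσ hσc ε hε hεΘ hεK δ d hδ hσ1
      ha hb hAid hA hT hTA ν α t t' ht' hν ht hpar, ENNReal.toReal_mul, ENNReal.coe_toReal, ENNReal.toReal_natCast, Complex.ofReal_mul,
    Complex.ofReal_natCast]

end Value

end Summit.HodgeConjecture.HodgeConjecture.R90.S6

end
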